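import Mathlib
import Literature.Analysis.ODE.RiccatiRecessiveUnique

/-!
# Crux `UniformPhotonSphereChannelsR` (K1R, stmt-FinalStateConjecture-14074), line
# `crum-peeling-recessive-tower` — stub: uniqueness of the recessive Riccati–Crum ladder

The registered stub `stub_recessiveUnique` of the line's skeleton (continuation lead c2): two
recessive Riccati–Crum ladders `(W k, U k)` and `(W' k, U' k)`, `k < ℓ`, over the SAME seed
potential `V` on a half-line `(X, ∞)` — i.e. `U 0 = U' 0 = V`, `W_k′ = U_k − W_k²`,
`U_{k+1} = 2 W_k² − U_k`, with the recessive normalisation `x · W_k(x) → k − ℓ` — coincide on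
`(X, ∞)`.  This identifies the hypothesised ladder of the crux with the explicit analytic one.

Proof: induction on the rung `k`.  Given `U k = U' k` on `(X, ∞)`, both `W k` and `W' k` solve the
same Riccati equation `W′ = U k − W²` there and are recessive with the same index
`c = ℓ − k > 0`, so they coincide by the landed
`Literature.Analysis.ODE.riccati_recessive_unique`; then `U (k+1) = U' (k+1)` on `(X, ∞)` by the
two rung laws.  The base `U 0 = U' 0` is the common seed.
-/

-- `Summit.<S>.<S>` repeats a namespace component by design (D-0017); off here as in the lakefile.
set_option linter.dupNamespace false

noncomputable section

namespace Summit.FinalStateConjecture.FinalStateConjecture.Theorems.CrumPeelingRecessiveTower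

open Filter Topology

/-- One rung of the uniqueness: if `W₁`, `W₂` solve `W′ = Uᵢ − W²` on `(X, ∞)` with potentials
`U₁ = U₂` there, and both are recessive with index `k − ℓ`, `k < ℓ`, then `W₁ = W₂` on `(X, ∞)`. -/
theorem recessiveUnique_rung {W₁ W₂ U₁ U₂ : ℝ → ℝ} {X : ℝ} {k ℓ : ℕ} (hk : k < ℓ)
    (hU : ∀ x, X < x → U₁ x = U₂ x)
    (h₁ : ∀ x, X < x → HasDerivAt W₁ (U₁ x - W₁ x ^ 2) x)
    (h₂ : ∀ x, X < x → HasDerivAt W₂ (U₂ x - W₂ x ^ 2) x)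
    (hl₁ : Tendsto (fun x => x * W₁ x) atTop (𝓝 ((k : ℝ) - ℓ)))
    (hl₂ : Tendsto (fun x => x * W₂ x) atTop (𝓝 ((k : ℝ) - ℓ))) :
    ∀ x, X < x → W₁ x = W₂ x := by
  have hc : 0 < (ℓ : ℝ) - k := by
    have : (k : ℝ) < ℓ := by exact_mod_cast hk
    linarith
  have hcast : ((k : ℝ) - ℓ) = -((ℓ : ℝ) - k) := by ring
  have h₂' : ∀ x, X < x → HasDerivAt W₂ (U₁ x - W₂ x ^ 2) x := by
    intro x hx
    rw [hU x hx]
    exact h₂ x hx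
  rw [hcast] at hl₁ hl₂
  exact Literature.Analysis.ODE.riccati_recessive_unique hc h₁ h₂' hl₁ hl₂

/-- **Stub (uniqueness of the recessive ladder).**  Two recessive Riccati–Crum ladders
`(W k, U k)` and `(W' k, U' k)`, `k < ℓ`, on `(X, ∞)` over the same seed `V` — `U 0 = U' 0 = V`,
`(W k)′ = U k − (W k)²`, `U (k+1) = 2 (W k)² − U k` (and likewise primed), `x · W k x → k − ℓ` and
`x · W' k x → k − ℓ` — coincide on `(X, ∞)`: `W k = W' k` and `U k = U' k` there for every
`k < ℓ`. -/
theorem stub_recessiveUnique :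
    ∀ (ℓ : ℕ) (V : ℝ → ℝ) (W U W' U' : ℕ → ℝ → ℝ) (X : ℝ),
      (∀ x, X < x → U 0 x = V x) → (∀ x, X < x → U' 0 x = V x) →
      (∀ k, k < ℓ → ∀ x, X < x → HasDerivAt (W k) (U k x - W k x ^ 2) x) →
      (∀ k, k < ℓ → ∀ x, X < x → HasDerivAt (W' k) (U' k x - W' k x ^ 2) x) →
      (∀ k, k < ℓ → ∀ x, X < x → U (k + 1) x = 2 * W k x ^ 2 - U k x) →
      (∀ k, k < ℓ → ∀ x, X < x → U' (k + 1) x = 2 * W' k x ^ 2 - U' k x) →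
      (∀ k, k < ℓ → Tendsto (fun x => x * W k x) atTop (𝓝 ((k : ℝ) - ℓ))) →
      (∀ k, k < ℓ → Tendsto (fun x => x * W' k x) atTop (𝓝 ((k : ℝ) - ℓ))) →
      ∀ k, k < ℓ → ∀ x, X < x → W k x = W' k x ∧ U k x = U' k x := by
  intro ℓ V W U W' U' X hU0 hU'0 hW hW' hU hU' hlim hlim'
  -- one rung: `U k = U' k` on `(X, ∞)` and `k < ℓ` give `W k = W' k` there
  have hWstep : ∀ k, k < ℓ → (∀ x, X < x → U k x = U' k x) →
      ∀ x, X < x → W k x = W' k x := fun k hk hUk =>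
    recessiveUnique_rung hk hUk (hW k hk) (hW' k hk) (hlim k hk) (hlim' k hk)
  -- induction on the rung: the potentials agree for every `k ≤ ℓ`
  have hUeq : ∀ k, k ≤ ℓ → ∀ x, X < x → U k x = U' k x := by
    intro k
    induction k with
    | zero =>
      intro _ x hx
      rw [hU0 x hx, hU'0 x hx]
    | succ k ih =>
      intro hk x hx
      have hk' : k < ℓ := hk
      have ihk := ih hk'.le
      rw [hU k hk' x hx, hU' k hk' x hx, hWstep k hk' ihk x hx, ihk x hx]
  intro k hk x hx
  exact ⟨hWstep k hk (hUeq k hk.le) x hx, hUeq k hk.le x hx⟩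

end Summit.FinalStateConjecture.FinalStateConjecture.Theorems.CrumPeelingRecessiveTower

end
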